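import Summits.AtomisticToContinuum.HydrodynamicLimit.Theorems.AntiMazurCoboundariesKineticWindowGronwallReorthCutPrelim
import Summits.AtomisticToContinuum.HydrodynamicLimit.Theorems.AntiMazurCoboundariesKineticWindowGronwallReorthCut
import HarnessLib

/-!
# The re-orthogonalised radial tail cut-off (stub `stub_tailReorth`, line `rare-band-ladder-dock` v7)

Crux `Summit.AtomisticToContinuum.HydrodynamicLimit.Theses.AntiMazurCoboundaries.KineticWindowGronwall`
(stmt-AtomisticToContinuum-9282, `= KineticFluxLdDecay → RelEntropyVanishing`), skeleton line `rare-band-ladder-dock`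
(v7), registered helper stub `stub_tailReorth : TailReorth` (pure Gaussian analysis on `ℝ³`, feeding the family glue
`stub_familyGlue`): for every `η > 0` and `R₀` there are a radius `R ≥ max(R₀, 1)`, a continuous radial cut-off `t`
squeezed between `(1 + ‖w‖²)·1{‖w‖ ≥ R}` and `(1 + ‖w‖²)·1{‖w‖ ≥ R − 1}`, and coefficients `|α|, |γ| ≤ η` such that
`t − (α + γ‖w‖²)` is orthogonal to the collision invariants `1, w, ‖w‖²` under the standard Gaussian `γ`. The
statements `Orth`, `TailReorth` are re-declared verbatim from the registered skeleton
`Cruxes/KineticWindowGronwall/Lines/rare_band_ladder_dock.lean`.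

PROOF. `t(w) := (1 + ‖w‖²) ω(‖w‖)` with the unit ramp `ω(r) = min 1 (max 0 (r − (R − 1)))`. The linear moments
`∫ (t − α − γ‖w‖²) w_j dγ` vanish by oddness (`w ↦ −w` preserves `γ`, the profile is even). `(α, γ)` solve the `2 × 2`
Gram system of `(1, ‖w‖²)`: with `∫ 1 = 1`, `∫ ‖w‖² = 3`, `∫ ‖w‖⁴ = D + 9`, `D := ∫ (‖w‖² − 3)² dγ > 0` (the Gaussian
charges open sets), `γ := (∫ t‖w‖² − 3∫ t)/D`, `α := ∫ t − 3γ`; orthogonality then follows from the five moments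
(`KineticWindowGronwallReorthCut.orth_of_moments`). Smallness without a limit argument: for `R ≥ 2`,
`ω(‖w‖) ≤ ‖w‖²/(R − 1)²`, hence `0 ≤ t, t‖w‖² ≤ (1 + ‖w‖²)³/(R − 1)²` and both tail moments are `≤ C/(R − 1)²`,
`C := ∫ (1 + ‖w‖²)³ dγ`; so `|γ| ≤ 4C/((R − 1)² D)`, `|α| ≤ C(1 + 12/D)/(R − 1)² ≤ η` once
`R − 1 ≥ max(1, C(1 + 12/D)/η)`. Folklore Gaussian calculus; nothing is cited and no Theses declaration is concluded.
-/

noncomputable section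

open MeasureTheory ProbabilityTheory
open scoped ENNReal InnerProductSpace

namespace Summit.AtomisticToContinuum.HydrodynamicLimit.Theorems.KineticWindowGronwallTailReorth

open Literature.MathematicalPhysics.KineticTheory
open KineticCurrentsWindowLDUniformSketch.ClassTruncation (integrable_of_le_lin integrable_one_add_norm_sq_cube)
open ClampedCurrentsDockCutoff (isOpenPosMeasure_stdGaussian_V3)
open KineticFluxLdDecayTilt (integral_eq_zero_of_odd_stdGaussian)
open KineticWindowGronwallReorthCut (orth_of_moments)

/-! ### The statements (verbatim from the line skeleton `rare_band_ladder_dock`, §1 and §1c) -/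

/-- `g ⊥ span{1, w, ‖w‖²}` in `L²(stdGaussian)` — the thermal-frame collision invariants (verbatim the line's clause). -/
def Orth (g : V3 → ℝ) : Prop :=
  ∀ (c₀ c₂ : ℝ) (b : V3), ∫ v, g v * (c₀ + inner ℝ b v + c₂ * ‖v‖ ^ 2) ∂(ProbabilityTheory.stdGaussian V3) = 0

/-- **Helper stub `TailReorth` (v7; pure Gaussian analysis on `ℝ³`): the re-orthogonalised radial tail cut-off.** For every
`η > 0` and `R₀` there are a radius `R ≥ max(R₀, 1)`, a continuous radial cut-off `t` with `0 ≤ t ≤ 1 + ‖w‖²`, `t w = 1 + ‖w‖²` for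
`‖w‖ ≥ R`, `t w = 0` for `‖w‖ ≤ R − 1`, and constants `|α|, |γ| ≤ η` such that `t − (α + γ‖w‖²)` is orthogonal to
`span(1, w, ‖w‖²)` under the standard Gaussian. Proof plan: `t(w) := (1 + ‖w‖²)·min(1, max(0, ‖w‖ − (R − 1)))`; the linear part of
the orthogonality is free by oddness (`w ↦ −w` preserves the Gaussian, `t` is even); `(α, γ)` solve the `2 × 2` Gram system of
`(1, ‖w‖²)` (nonsingular: `∫ (‖w‖² − 3)² dγ > 0`) against `(∫ t dγ, ∫ t‖w‖² dγ)`, and both right-hand sides are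
`≤ ∫ (1 + ‖w‖²)³ dγ / (R − 1)²`, so `|α|, |γ| ≤ η` for `R` large. -/
def TailReorth : Prop :=
  ∀ η : ℝ, 0 < η → ∀ R₀ : ℝ, ∃ R : ℝ, R₀ ≤ R ∧ 1 ≤ R ∧ ∃ (t : V3 → ℝ) (α γ : ℝ),
    Continuous t ∧ |α| ≤ η ∧ |γ| ≤ η ∧
    (∀ w, 0 ≤ t w) ∧ (∀ w, t w ≤ 1 + ‖w‖ ^ 2) ∧ (∀ w, R ≤ ‖w‖ → t w = 1 + ‖w‖ ^ 2) ∧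
    (∀ w, ‖w‖ ≤ R - 1 → t w = 0) ∧
    Orth (fun w => t w - (α + γ * ‖w‖ ^ 2))

/-! ### The unit ramp and two Gaussian constants -/

/-- The unit ramp `ω(r) = min 1 (max 0 (r − (R − 1)))`: continuous, values in `[0,1]`, `= 1` on `r ≥ R`, `= 0` on
`r ≤ R − 1`. [folklore] -/
theorem ramp_props (R : ℝ) {ω : ℝ → ℝ} (hω : ∀ r, ω r = min 1 (max 0 (r - (R - 1)))) :
    Continuous ω ∧ (∀ r, 0 ≤ ω r) ∧ (∀ r, ω r ≤ 1) ∧ (∀ r, R ≤ r → ω r = 1) ∧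
      (∀ r, r ≤ R - 1 → ω r = 0) := by
  have hfun : ω = fun r => min 1 (max 0 (r - (R - 1))) := funext hω
  refine ⟨by rw [hfun]; fun_prop, fun r => by rw [hω]; exact le_min zero_le_one (le_max_left _ _),
    fun r => by rw [hω]; exact min_le_left _ _, fun r hr => ?_, fun r hr => ?_⟩
  · rw [hω, min_eq_left]
    exact le_max_of_le_right (by linarith)
  · rw [hω, max_eq_left (by linarith), min_eq_right zero_le_one]

/-- `∫ ‖w‖² dγ = 3` on `ℝ³`. [folklore] -/
theorem integral_norm_sq_three : ∫ w, ‖w‖ ^ 2 ∂stdGaussian V3 = 3 := by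
  rw [integral_norm_sq_stdGaussian, Fintype.card_fin]; norm_num

/-- `∫ (‖w‖² − 3)² dγ = ∫ ‖w‖⁴ dγ − 9` on `ℝ³`. [folklore] -/
theorem integral_central_fourth_eq :
    ∫ w, (‖w‖ ^ 2 - 3) ^ 2 ∂stdGaussian V3 = ∫ w, ‖w‖ ^ 4 ∂stdGaussian V3 - 9 := by
  have h : (fun w : V3 => (‖w‖ ^ 2 - 3) ^ 2) = fun w => ‖w‖ ^ 4 - 6 * ‖w‖ ^ 2 + 9 := by
    funext w; ring
  have hI : Integrable (fun w : V3 => ‖w‖ ^ 4 - 6 * ‖w‖ ^ 2) (stdGaussian V3) :=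
    integrable_norm_pow_four_stdGaussian.sub (integrable_norm_sq_stdGaussian.const_mul 6)
  rw [h, integral_add hI (integrable_const _),
    integral_sub integrable_norm_pow_four_stdGaussian (integrable_norm_sq_stdGaussian.const_mul _),
    integral_const_mul, integral_norm_sq_three, integral_const, probReal_univ, one_smul]
  ring

/-- `∫ (‖w‖² − 3)² dγ > 0`: the integrand is continuous, nonnegative, `= 9` at `w = 0`, and the standard Gaussian
charges open sets. [folklore] -/
theorem integral_central_fourth_pos : 0 < ∫ w, (‖w‖ ^ 2 - 3) ^ 2 ∂stdGaussian V3 := by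
  haveI := isOpenPosMeasure_stdGaussian_V3
  -- integrability: `(‖w‖² − 3)² = ‖w‖⁴ − 6‖w‖² + 9` (Fernique moments)
  have h : (fun w : V3 => (‖w‖ ^ 2 - 3) ^ 2) = fun w => ‖w‖ ^ 4 - 6 * ‖w‖ ^ 2 + 9 := by
    funext w; ring
  have hi : Integrable (fun w : V3 => (‖w‖ ^ 2 - 3) ^ 2) (stdGaussian V3) := by
    rw [h]
    exact (integrable_norm_pow_four_stdGaussian.sub (integrable_norm_sq_stdGaussian.const_mul _)).add
      (integrable_const _)
  exact integral_pos_of_integrable_nonneg_nonzero (x := (0 : V3)) (by fun_prop) hi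
    (fun w => sq_nonneg _) (by norm_num)

/-! ### The stub -/

/-- **Stub `stub_tailReorth`** (line `rare-band-ladder-dock` v7, crux stmt-AtomisticToContinuum-9282): the
re-orthogonalised radial tail cut-off exists. `t(w) = (1 + ‖w‖²) ω(‖w‖)` with the unit ramp `ω` between `R − 1` and
`R`; linear moments vanish by oddness; `(α, γ)` solve the Gram system of `(1, ‖w‖²)` (determinant
`D = ∫ (‖w‖² − 3)² dγ > 0`); both tail moments are `≤ ∫ (1 + ‖w‖²)³ dγ / (R − 1)²`, whence `|α|, |γ| ≤ η` for
`R − 1 ≥ max(1, C(1 + 12/D)/η)`. [folklore] -/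
theorem stub_tailReorth : TailReorth := by
  intro η hη R₀
  /- Step 1: Gaussian constants `C = ∫ (1 + ‖w‖²)³ dγ`, `D = ∫ (‖w‖² − 3)² dγ = ∫ ‖w‖⁴ dγ − 9 > 0`. -/
  obtain ⟨C, hC⟩ : ∃ C : ℝ, C = ∫ w, (1 + ‖w‖ ^ 2) ^ 3 ∂stdGaussian V3 := ⟨_, rfl⟩
  have hC0 : 0 ≤ C := hC ▸ integral_nonneg fun w => by positivity
  obtain ⟨D, hD⟩ : ∃ D : ℝ, D = ∫ w, (‖w‖ ^ 2 - 3) ^ 2 ∂stdGaussian V3 := ⟨_, rfl⟩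
  have hD0 : 0 < D := hD ▸ integral_central_fourth_pos
  have hD4 : ∫ w, ‖w‖ ^ 4 ∂stdGaussian V3 = D + 9 := by
    rw [hD, integral_central_fourth_eq]; ring
  /- Step 2: the radius `R = max (max R₀ 2) (Q + 1)`, `Q = C (1 + 12/D) / η`. -/
  obtain ⟨Q, hQ⟩ : ∃ Q : ℝ, Q = C * (1 + 12 / D) / η := ⟨_, rfl⟩
  have hQ0 : 0 ≤ Q := by rw [hQ]; positivity
  obtain ⟨R, hR⟩ : ∃ R : ℝ, R = max (max R₀ 2) (Q + 1) := ⟨_, rfl⟩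
  have hR₀ : R₀ ≤ R := by rw [hR]; exact le_max_of_le_left (le_max_left _ _)
  have hR2 : 2 ≤ R := by rw [hR]; exact le_max_of_le_left (le_max_right _ _)
  have hRQ : Q + 1 ≤ R := by rw [hR]; exact le_max_right _ _
  have hR1 : 1 ≤ R - 1 := by linarith
  have hRQ' : Q ≤ (R - 1) ^ 2 := by
    calc Q ≤ (R - 1) * 1 := by linarith
      _ ≤ (R - 1) * (R - 1) := mul_le_mul_of_nonneg_left hR1 (by linarith)
      _ = (R - 1) ^ 2 := by ring
  have hRpos : 0 < (R - 1) ^ 2 := by positivity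
  refine ⟨R, hR₀, by linarith, ?_⟩
  /- Step 3: the ramp `ω` and the cut-off `t = (1 + ‖w‖²) ω(‖w‖)`. -/
  obtain ⟨ω, hω⟩ : ∃ ω : ℝ → ℝ, ∀ r, ω r = min 1 (max 0 (r - (R - 1))) := ⟨_, fun r => rfl⟩
  obtain ⟨hωc, hω0, hω1, hωhi, hωlo⟩ := ramp_props R hω
  obtain ⟨t, ht⟩ : ∃ t : V3 → ℝ, t = fun w => (1 + ‖w‖ ^ 2) * ω ‖w‖ := ⟨_, rfl⟩
  have htw : ∀ w, t w = (1 + ‖w‖ ^ 2) * ω ‖w‖ := fun w => by rw [ht]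
  have htc : Continuous t := by rw [ht]; fun_prop
  have ht0 : ∀ w, 0 ≤ t w := fun w => by rw [htw]; exact mul_nonneg (by positivity) (hω0 _)
  have ht1 : ∀ w, t w ≤ 1 + ‖w‖ ^ 2 := fun w => by
    rw [htw]; exact mul_le_of_le_one_right (by positivity) (hω1 _)
  have htb : ∀ w, |t w| ≤ 1 * (1 + ‖w‖ ^ 2) := fun w => by
    rw [abs_of_nonneg (ht0 w), one_mul]; exact ht1 w
  have hteven : ∀ w, t (-w) = t w := fun w => by rw [htw, htw, norm_neg]
  -- tail domination `ω(‖w‖) (R − 1)² ≤ ‖w‖²`, hence `t, t‖w‖² ≤ (1 + ‖w‖²)³ / (R − 1)²`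
  have hωsq : ∀ w : V3, ω ‖w‖ * (R - 1) ^ 2 ≤ ‖w‖ ^ 2 := by
    intro w
    by_cases h : ‖w‖ ≤ R - 1
    · rw [hωlo _ h, zero_mul]; positivity
    · calc ω ‖w‖ * (R - 1) ^ 2 ≤ 1 * (R - 1) ^ 2 := mul_le_mul_of_nonneg_right (hω1 _) hRpos.le
        _ ≤ ‖w‖ ^ 2 := by
            rw [one_mul]; exact pow_le_pow_left₀ (by linarith) (not_le.1 h).le 2
  have htdom : ∀ w, t w ≤ (1 + ‖w‖ ^ 2) ^ 3 * (1 / (R - 1) ^ 2) := by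
    intro w
    have hs := sq_nonneg ‖w‖
    have hs2 := sq_nonneg (‖w‖ ^ 2)
    rw [htw, mul_one_div, le_div_iff₀ hRpos]
    calc (1 + ‖w‖ ^ 2) * ω ‖w‖ * (R - 1) ^ 2 = (1 + ‖w‖ ^ 2) * (ω ‖w‖ * (R - 1) ^ 2) := by ring
      _ ≤ (1 + ‖w‖ ^ 2) * ‖w‖ ^ 2 := mul_le_mul_of_nonneg_left (hωsq w) (by positivity)
      _ ≤ (1 + ‖w‖ ^ 2) ^ 3 := by nlinarith [mul_nonneg hs hs2]
  have htdom' : ∀ w, t w * ‖w‖ ^ 2 ≤ (1 + ‖w‖ ^ 2) ^ 3 * (1 / (R - 1) ^ 2) := by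
    intro w
    have hs := sq_nonneg ‖w‖
    have hs2 := sq_nonneg (‖w‖ ^ 2)
    rw [htw, mul_one_div, le_div_iff₀ hRpos]
    calc (1 + ‖w‖ ^ 2) * ω ‖w‖ * ‖w‖ ^ 2 * (R - 1) ^ 2
        = (1 + ‖w‖ ^ 2) * ‖w‖ ^ 2 * (ω ‖w‖ * (R - 1) ^ 2) := by ring
      _ ≤ (1 + ‖w‖ ^ 2) * ‖w‖ ^ 2 * ‖w‖ ^ 2 := mul_le_mul_of_nonneg_left (hωsq w) (by positivity)
      _ ≤ (1 + ‖w‖ ^ 2) ^ 3 := by nlinarith [mul_nonneg hs hs2]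
  /- Step 4: the two tail moments `T0 = ∫ t`, `T2 = ∫ t‖w‖²` lie in `[0, P]`, `P = C/(R − 1)²`. -/
  obtain ⟨hti, -, htis⟩ := integrable_of_le_lin htc htb
  obtain ⟨T0, hT0⟩ : ∃ T : ℝ, T = ∫ w, t w ∂stdGaussian V3 := ⟨_, rfl⟩
  obtain ⟨T2, hT2⟩ : ∃ T : ℝ, T = ∫ w, t w * ‖w‖ ^ 2 ∂stdGaussian V3 := ⟨_, rfl⟩
  obtain ⟨P, hP⟩ : ∃ P : ℝ, P = C * (1 / (R - 1) ^ 2) := ⟨_, rfl⟩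
  have hP0 : 0 ≤ P := by rw [hP]; positivity
  have hIC : Integrable (fun w : V3 => (1 + ‖w‖ ^ 2) ^ 3 * (1 / (R - 1) ^ 2)) (stdGaussian V3) :=
    integrable_one_add_norm_sq_cube.mul_const _
  have hT00 : 0 ≤ T0 := hT0 ▸ integral_nonneg ht0
  have hT20 : 0 ≤ T2 := hT2 ▸ integral_nonneg fun w => mul_nonneg (ht0 w) (sq_nonneg _)
  have hT0P : T0 ≤ P := by
    rw [hT0, hP, hC, ← integral_mul_const]
    exact integral_mono_of_nonneg (ae_of_all _ ht0) hIC (ae_of_all _ htdom)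
  have hT2P : T2 ≤ P := by
    rw [hT2, hP, hC, ← integral_mul_const]
    exact integral_mono_of_nonneg (ae_of_all _ fun w => mul_nonneg (ht0 w) (sq_nonneg _)) hIC
      (ae_of_all _ htdom')
  /- Step 5: the Gram system of `(1, ‖w‖²)`: `γ = (T2 − 3 T0)/D`, `α = T0 − 3γ`, and the bounds. -/
  obtain ⟨γ, hγ⟩ : ∃ x : ℝ, x = (T2 - 3 * T0) / D := ⟨_, rfl⟩
  obtain ⟨α, hα⟩ : ∃ x : ℝ, x = T0 - 3 * γ := ⟨_, rfl⟩
  have hγD : γ * D = T2 - 3 * T0 := by rw [hγ, div_mul_cancel₀ _ hD0.ne']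
  have hγb : |γ| ≤ 4 * P / D := by
    rw [hγ, abs_div, abs_of_pos hD0]
    exact div_le_div_of_nonneg_right (abs_le.2 ⟨by linarith, by linarith⟩) hD0.le
  have hαb : |α| ≤ P * (1 + 12 / D) := by
    rw [hα]
    calc |T0 - 3 * γ| ≤ |T0| + |3 * γ| := abs_sub _ _
      _ = T0 + 3 * |γ| := by
          rw [abs_of_nonneg hT00, abs_mul, abs_of_pos (by norm_num : (0 : ℝ) < 3)]
      _ ≤ P + 3 * (4 * P / D) := add_le_add hT0P (mul_le_mul_of_nonneg_left hγb (by norm_num))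
      _ = P * (1 + 12 / D) := by ring
  have hPη : P * (1 + 12 / D) ≤ η := by
    have h1 : η * Q = C * (1 + 12 / D) := by rw [hQ, mul_div_assoc', mul_div_cancel_left₀ _ hη.ne']
    have h2 : P * (1 + 12 / D) = η * Q / (R - 1) ^ 2 := by rw [hP, h1]; ring
    rw [h2, div_le_iff₀ hRpos]
    exact mul_le_mul_of_nonneg_left hRQ' hη.le
  have hγη : |γ| ≤ η := by
    refine hγb.trans (le_trans ?_ hPη)
    calc 4 * P / D ≤ 12 * P / D := div_le_div_of_nonneg_right (by linarith) hD0.le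
      _ ≤ P + 12 * P / D := le_add_of_nonneg_left hP0
      _ = P * (1 + 12 / D) := by ring
  /- Step 6: the three moment identities of `G = t − (α + γ‖w‖²)` and orthogonality. -/
  have hIq : Integrable (fun w : V3 => α + γ * ‖w‖ ^ 2) (stdGaussian V3) :=
    (integrable_const α).add (integrable_norm_sq_stdGaussian.const_mul γ)
  have h0 : ∫ w, (t w - (α + γ * ‖w‖ ^ 2)) ∂stdGaussian V3 = 0 := by
    rw [integral_sub hti hIq, integral_add (integrable_const α) (integrable_norm_sq_stdGaussian.const_mul γ),
      integral_const, integral_const_mul, integral_norm_sq_three, ← hT0, probReal_univ, one_smul, hα]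
    ring
  have h1 : ∀ j, ∫ w, (t w - (α + γ * ‖w‖ ^ 2)) * w j ∂stdGaussian V3 = 0 := fun j =>
    integral_eq_zero_of_odd_stdGaussian fun w => by
      simp only [PiLp.neg_apply, norm_neg, hteven]; ring
  have h2 : ∫ w, (t w - (α + γ * ‖w‖ ^ 2)) * ‖w‖ ^ 2 ∂stdGaussian V3 = 0 := by
    have he : (fun w : V3 => (t w - (α + γ * ‖w‖ ^ 2)) * ‖w‖ ^ 2) =
        fun w => t w * ‖w‖ ^ 2 - (α * ‖w‖ ^ 2 + γ * ‖w‖ ^ 4) := by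
      funext w; ring
    have hI24 : Integrable (fun w : V3 => α * ‖w‖ ^ 2 + γ * ‖w‖ ^ 4) (stdGaussian V3) :=
      (integrable_norm_sq_stdGaussian.const_mul α).add (integrable_norm_pow_four_stdGaussian.const_mul γ)
    rw [he, integral_sub htis hI24,
      integral_add (integrable_norm_sq_stdGaussian.const_mul α)
        (integrable_norm_pow_four_stdGaussian.const_mul γ),
      integral_const_mul, integral_const_mul, integral_norm_sq_three, hD4, ← hT2, hα]
    linear_combination (-1 : ℝ) * hγD
  have hGb : ∀ w, |t w - (α + γ * ‖w‖ ^ 2)| ≤ (1 + |α| + |γ|) * (1 + ‖w‖ ^ 2) := by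
    intro w
    have hs := sq_nonneg ‖w‖
    calc |t w - (α + γ * ‖w‖ ^ 2)| ≤ |t w| + |α + γ * ‖w‖ ^ 2| := abs_sub _ _
      _ ≤ |t w| + (|α| + |γ * ‖w‖ ^ 2|) := add_le_add le_rfl (abs_add_le _ _)
      _ ≤ 1 * (1 + ‖w‖ ^ 2) + (|α| * (1 + ‖w‖ ^ 2) + |γ| * (1 + ‖w‖ ^ 2)) := by
          refine add_le_add (htb w) (add_le_add ?_ ?_)
          · exact le_mul_of_one_le_right (abs_nonneg _) (by linarith)
          · rw [abs_mul, abs_of_nonneg hs]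
            exact mul_le_mul_of_nonneg_left (by linarith) (abs_nonneg _)
      _ = (1 + |α| + |γ|) * (1 + ‖w‖ ^ 2) := by ring
  refine ⟨t, α, γ, htc, hαb.trans hPη, hγη, ht0, ht1, fun w hw => ?_, fun w hw => ?_, fun c₀ c₂ b => ?_⟩
  · rw [htw, hωhi _ hw, mul_one]
  · rw [htw, hωlo _ hw, mul_zero]
  · exact orth_of_moments (G := fun w => t w - (α + γ * ‖w‖ ^ 2)) (by fun_prop) hGb h0 h1 h2 c₀ c₂ b

end Summit.AtomisticToContinuum.HydrodynamicLimit.Theorems.KineticWindowGronwallTailReorth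

end
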